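import Summits.Ventures.HodgeRepro2.A2ModelConjugation
import Summits.Ventures.HodgeRepro2.A2TheoremAClassModel

/-!
# A2PeriodConjugation — the non-vanishing criterion (N) is invariant under complex conjugation

Tier-4 annex of sub-claim A2 (seat p6, cell pub-hodge-repro2); §8(d): uses an L-value-free
non-vanishing device: NO.

Row 97 reads the non-vanishing input (N) of Theorem A in the model: `p_W(z ⋆ θ^r) ≠ 0` iff some
period `∫_B z ∧ w_σ` (`w_σ = weil P₀ s` the Weil monomials of the family `W`) is non-zero.  The
complex conjugation of row 132 sends the Weil monomial `w_{P₀,s}` to `w_{P₀,!s}` EXACTLY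
(`conjA_weil`: the swap `a_p ↔ b_p` exchanges the two Weil monomials of a face, and the
coefficient conjugation fixes them), so the periods of `conjA z` are the conjugates of the
periods of `z` at the conjugate Weil data, up to the orientation sign `(−1)^n`
(`integral_conjA_mul_weil`).  For a family `W` closed under `s ↦ !s` (as the family of Theorem A,
which contains `σ` together with `σ̄`) the criterion (N) is therefore CONJUGATION-INVARIANT:

  `p_W(conjA z ⋆ θ^r) ≠ 0  ⟺  p_W(z ⋆ θ^r) ≠ 0`   (`weilProjModel_pontryagin_conjA_ne_zero_iff`),

and the twelve-plane instance for Theorem A's class (`weilProjModel_class_conjA_ne_zero_iff`).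
In the prose: (N) is a statement about a real class (the surface class `z = f_*(1)` is real) and
it does not depend on the choice of `σ` versus `σ̄` inside a conjugate pair.  What stays prose:
the identification `∫_B z ∧ w_σ = ∫_S f^* w_σ` (A4.1.1 (ii)) and the model with `H^*(B, ℂ)`;
not on the N1 chain.
-/

namespace Summit.Ventures.HodgeRepro2.A2PeriodConjugation

open WeilPlanes WeilIntegral WeilCoproduct WeilDetect A2ModelDuality A2PontryaginModel
  A2HodgeSymmetry A2CoefficientConjugation A2ModelConjugation A2HodgeBigrading

variable {ι : Type*} [DecidableEq ι] [Fintype ι]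

omit [Fintype ι] in
/-- The swap exchanges the two Weil monomials of a face: `swapA (w_{P₀,s}) = w_{P₀,!s}`. -/
theorem swapA_weil (P₀ : Finset ι) (s : Bool) : swapA (weil P₀ s) = weil P₀ (!s) := by
  simp only [weil, swapA_mono, List.map_map]
  rfl

/-- The coefficient conjugation fixes the Weil monomials (`± e_s` for a basis monomial `e_s`). -/
theorem coeffConj_weil (P₀ : Finset ι) (s : Bool) : coeffConj (weil P₀ s) = weil P₀ s := by
  obtain ⟨ε, hε, h⟩ := exists_sign_mono_eq_aBasis (nodup_weilList P₀ s)
  show coeffConj (mono (weilList P₀ s)) = mono (weilList P₀ s)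
  rw [h, coeffConj_sign_smul_aBasis hε]

/-- `conjA (w_{P₀,s}) = w_{P₀,!s}` exactly. -/
theorem conjA_weil (P₀ : Finset ι) (s : Bool) : conjA (weil P₀ s) = weil P₀ (!s) := by
  rw [conjA_apply, coeffConj_weil, swapA_weil]

/-- The periods of `conjA z` are the conjugate periods of `z` at the conjugate Weil data, up to
the orientation sign: `∫_B (conjA z) ∧ w_{P₀,s} = (−1)^n · conj (∫_B z ∧ w_{P₀,!s})`. -/
theorem integral_conjA_mul_weil (z : A ι) (P₀ : Finset ι) (s : Bool) :
    integral (conjA z * weil P₀ s) =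
      (-1 : ℂ) ^ Fintype.card ι * (starRingEnd ℂ) (integral (z * weil P₀ (!s))) := by
  have h : conjA z * weil P₀ s = conjA (z * weil P₀ (!s)) := by
    rw [conjA_mul, conjA_weil, Bool.not_not]
  rw [h, integral_conjA]

/-- `∫_B (conjA z) ∧ w_{P₀,s} ≠ 0 ⟺ ∫_B z ∧ w_{P₀,!s} ≠ 0`. -/
theorem integral_conjA_mul_weil_ne_zero_iff (z : A ι) (P₀ : Finset ι) (s : Bool) :
    integral (conjA z * weil P₀ s) ≠ 0 ↔ integral (z * weil P₀ (!s)) ≠ 0 := by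
  rw [integral_conjA_mul_weil, mul_ne_zero_iff, map_ne_zero]
  refine ⟨fun h => h.2, fun h => ⟨?_, h⟩⟩
  rcases neg_one_pow_eq_or ℂ (Fintype.card ι) with h1 | h1 <;> rw [h1] <;> norm_num

/-- For a family `W` closed under `s ↦ !s`, some period of `conjA z` is non-zero iff some period
of `z` is. -/
theorem exists_integral_conjA_mul_weil_ne_zero_iff (W : Finset (Finset ι × Bool))
    (hW : ∀ d ∈ W, (d.1, !d.2) ∈ W) (z : A ι) :
    (∃ d ∈ W, integral (conjA z * weil d.1 (!d.2)) ≠ 0) ↔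
      ∃ d ∈ W, integral (z * weil d.1 (!d.2)) ≠ 0 := by
  constructor
  · rintro ⟨d, hd, h⟩
    refine ⟨(d.1, !d.2), hW d hd, ?_⟩
    rw [integral_conjA_mul_weil_ne_zero_iff, Bool.not_not] at h
    simpa using h
  · rintro ⟨d, hd, h⟩
    refine ⟨(d.1, !d.2), hW d hd, ?_⟩
    rw [integral_conjA_mul_weil_ne_zero_iff]
    simpa using h

/-- THE CRITERION (N) IS CONJUGATION-INVARIANT: for a family `W` of Weil data of common size
`r ≥ 1` closed under `s ↦ !s`, and all `c_p ≠ 0`,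
`p_W(conjA z ⋆ θ^r) ≠ 0 ⟺ p_W(z ⋆ θ^r) ≠ 0` (row 97 on both sides). -/
theorem weilProjModel_pontryagin_conjA_ne_zero_iff (W : Finset (Finset ι × Bool)) (r : ℕ)
    (hr : 1 ≤ r) (hWr : ∀ d ∈ W, d.1.card = r) (hW : ∀ d ∈ W, (d.1, !d.2) ∈ W) (c : ι → ℂ)
    (hc : ∀ p, c p ≠ 0) (z : A ι) :
    A2WeilProjection.weilProjModel W (pontryagin (conjA z) (theta c ^ r)) ≠ 0 ↔
      A2WeilProjection.weilProjModel W (pontryagin z (theta c ^ r)) ≠ 0 := by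
  rw [A2WeilProjectionPeriod.weilProjModel_pontryagin_ne_zero_iff W r hr hWr c hc,
    A2WeilProjectionPeriod.weilProjModel_pontryagin_ne_zero_iff W r hr hWr c hc]
  exact exists_integral_conjA_mul_weil_ne_zero_iff W hW z

/-- THE TWELVE-PLANE INSTANCE for Theorem A's class: (N) for `conjA z` is (N) for `z`. -/
theorem weilProjModel_class_conjA_ne_zero_iff (c : A2TwelvePlanes.ι₁₂ → ℂ) (hc : ∀ p, c p ≠ 0)
    (z : A A2TwelvePlanes.ι₁₂) (W : Finset (Finset A2TwelvePlanes.ι₁₂ × Bool))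
    (hWr : ∀ d ∈ W, d.1.card = 4) (hW : ∀ d ∈ W, (d.1, !d.2) ∈ W) :
    A2WeilProjection.weilProjModel W (pontryagin (conjA z) (theta c ^ 4)) ≠ 0 ↔
      A2WeilProjection.weilProjModel W (pontryagin z (theta c ^ 4)) ≠ 0 :=
  weilProjModel_pontryagin_conjA_ne_zero_iff W 4 (by norm_num) hWr hW c hc z

/-- For a REAL surface class `z` the criterion (N) may be read at either member of each
conjugate pair: `∫_B z ∧ w_{P₀,s} ≠ 0 ⟺ ∫_B z ∧ w_{P₀,!s} ≠ 0`. -/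
theorem integral_mul_weil_ne_zero_iff_of_real {z : A ι} (hz : conjA z = z) (P₀ : Finset ι)
    (s : Bool) : integral (z * weil P₀ s) ≠ 0 ↔ integral (z * weil P₀ (!s)) ≠ 0 := by
  conv_lhs => rw [← hz]
  exact integral_conjA_mul_weil_ne_zero_iff z P₀ s

end Summit.Ventures.HodgeRepro2.A2PeriodConjugation
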